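import Summits.Ventures.HodgeRepro.SingleClass

/-!
# No face is single-class, degree 12: `C12`, `c = cc_C12`

Blind re-derivation cell `pub-hodge-repro`, seat `typer` (gen 4).  One of the six degree-12 files
(`SingleClass12C12`, `SingleClass12C6xC2a/b/c`, `SingleClass12D6`, `SingleClass12Dic3`), one file per
`(G, c)` because each `decide +kernel` row enumerates the `4096` subsets of `G` (≈ 10 s) and more than
five such rows in one module overloads a farm node.  Method (`SingleClass.lean`): translation by `p⁻¹`
puts the first place at the identity (`not_isSingleClass_of_one`) and the second place depends only on
its conjugacy class (`faceCorners_conj_right`), so five rows `(Φ; 1, p′)`, one per place other than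
the place of `1`, settle `route/ROUTE.md` §3.4's «NO face … is single-class» for this `(G, c)`.
-/

open Finset
open scoped Pointwise
open Multiplicative

namespace HodgeRepro

/-! ### `C12`, `c = cc_C12` -/
/-- Degree-12 row `C12`: faces `(Φ; 1, ofAdd 1)` are not single-class (`decide +kernel`). -/
theorem row_C12_1 : ∀ Φ : Finset C12, IsCMType cc_C12 Φ →
    ¬ IsSingleClass (faceCorners cc_C12 Φ 1 (ofAdd 1)) := by
  decide +kernel

/-- Degree-12 row `C12`: faces `(Φ; 1, ofAdd 2)` are not single-class (`decide +kernel`). -/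
theorem row_C12_2 : ∀ Φ : Finset C12, IsCMType cc_C12 Φ →
    ¬ IsSingleClass (faceCorners cc_C12 Φ 1 (ofAdd 2)) := by
  decide +kernel

/-- Degree-12 row `C12`: faces `(Φ; 1, ofAdd 3)` are not single-class (`decide +kernel`). -/
theorem row_C12_3 : ∀ Φ : Finset C12, IsCMType cc_C12 Φ →
    ¬ IsSingleClass (faceCorners cc_C12 Φ 1 (ofAdd 3)) := by
  decide +kernel

/-- Degree-12 row `C12`: faces `(Φ; 1, ofAdd 4)` are not single-class (`decide +kernel`). -/
theorem row_C12_4 : ∀ Φ : Finset C12, IsCMType cc_C12 Φ →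
    ¬ IsSingleClass (faceCorners cc_C12 Φ 1 (ofAdd 4)) := by
  decide +kernel

/-- Degree-12 row `C12`: faces `(Φ; 1, ofAdd 5)` are not single-class (`decide +kernel`). -/
theorem row_C12_5 : ∀ Φ : Finset C12, IsCMType cc_C12 Φ →
    ¬ IsSingleClass (faceCorners cc_C12 Φ 1 (ofAdd 5)) := by
  decide +kernel

/-- **No face of `(C12, cc_C12)` is single-class** (assembled from the five rows by the symmetries of
`SingleClass.lean`). -/
theorem not_isSingleClass_face_C12 : ∀ Φ : Finset C12, IsCMType cc_C12 Φ → ∀ p p' : C12,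
    p' ∉ place cc_C12 p → ¬ IsSingleClass (faceCorners cc_C12 Φ p p') := by
  apply not_isSingleClass_of_one cc_C12_isComplexConj
  intro Φ hΦ p' hp'
  have hcases : ∀ q : C12, q ∈ place cc_C12 1 ∨ q = ofAdd 1 ∨ q = ofAdd 2 ∨ q = ofAdd 3 ∨ q = ofAdd 4 ∨ q = ofAdd 5 ∨ q = cc_C12 * (ofAdd 1) ∨ q = cc_C12 * (ofAdd 2) ∨ q = cc_C12 * (ofAdd 3) ∨ q = cc_C12 * (ofAdd 4) ∨ q = cc_C12 * (ofAdd 5) := by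
    decide
  rcases hcases p' with h | rfl | rfl | rfl | rfl | rfl | rfl | rfl | rfl | rfl | rfl
  · exact absurd h hp'
  · exact row_C12_1 Φ hΦ
  · exact row_C12_2 Φ hΦ
  · exact row_C12_3 Φ hΦ
  · exact row_C12_4 Φ hΦ
  · exact row_C12_5 Φ hΦ
  · rw [faceCorners_conj_right cc_C12_isComplexConj]
    exact row_C12_1 Φ hΦ
  · rw [faceCorners_conj_right cc_C12_isComplexConj]
    exact row_C12_2 Φ hΦ
  · rw [faceCorners_conj_right cc_C12_isComplexConj]
    exact row_C12_3 Φ hΦ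
  · rw [faceCorners_conj_right cc_C12_isComplexConj]
    exact row_C12_4 Φ hΦ
  · rw [faceCorners_conj_right cc_C12_isComplexConj]
    exact row_C12_5 Φ hΦ

end HodgeRepro
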